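import Literature.Probability.LatticeModels.ModifiedSimonInequality
import Literature.Probability.LatticeModels.LoopO1
import HarnessLib

/-!
# The one-edge law (toggling bijection) of the high-temperature expansion in a domain

Stub `stub_hteToggle` of the line `loop-footprint-strand-mass` for the crux `StrandShadow`
(stmt-CriticalPhenomena-14626).

For a finite simple graph `G`, a domain `Λ`, a source set `A`, a weight `t` and an edge
`e = s(u, v) ∈ edgesIn G Λ` (so `u ≠ v` and `u, v ∈ Λ`), removing `e` is a bijection from the
high-temperature graphs `R ⊆ edgesIn G Λ` with `oddVerts Λ R = A` and `e ∈ R` onto the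
high-temperature graphs `R' ⊆ edgesIn G Λ` with `oddVerts Λ R' = A ∆ {u, v}` and `e ∉ R'`
(inverse `R' ↦ insert e R'`; the degrees at `u` and `v` change by one, all other degrees are
unchanged, `oddVerts_insert`), and `t ^ |R| = t * t ^ |R.erase e|`.  Summing gives the one-edge law
`Σ_{∂R = A, e ∈ R} t^|R| = t · Σ_{∂R' = A ∆ {u,v}, e ∉ R'} t^|R'|`, with `{u, v}` written
`univ.filter (· ∈ e)` so that the statement does not destructure `e`.
-/

noncomputable section

open Finset SimpleGraph
open Literature.Probability.LatticeModels

namespace Summit.CriticalPhenomena.Ising3DConformalLimit.Theorems.StrandShadowFootprint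

open scoped Classical symmDiff

/-- The endpoint set of `s(x, y)`, written as a filter of `univ`, is the pair `{x, y}`. -/
theorem filter_mem_sym2Mk_eq_pair {V : Type} [Fintype V] [DecidableEq V] (x y : V) :
    (Finset.univ.filter fun w : V => w ∈ s(x, y)) = ({x, y} : Finset V) := by
  ext w
  simp [Sym2.mem_iff]

/-- **One-edge law of the high-temperature expansion in a domain** (toggling bijection).
For an edge `e = uv` of `G` with both endpoints in `Λ` and any source set `A`, removing `e` is a
weight-`t` bijection from the HT graphs `R ⊆ ℰ_Λ` with `∂R = A`, `e ∈ R` onto the HT graphs with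
`∂R = A ∆ {u,v}`, `e ∉ R`:
`Σ_{∂R = A, e ∈ R} t^|R| = t · Σ_{∂R = A ∆ {u,v}, e ∉ R} t^|R|` (`{u,v}` written
`univ.filter (· ∈ e)`; `R ↦ R.erase e`, inverse `insert e`). -/
theorem stub_hteToggle :
    ∀ (V : Type) [Fintype V] [DecidableEq V] (G : SimpleGraph V) [DecidableRel G.Adj]
      (Λ A : Finset V) (t : ℝ) (e : Sym2 V), e ∈ edgesIn G Λ →
      (∑ R ∈ ((edgesIn G Λ).powerset.filter fun R : Finset (Sym2 V) => oddVerts Λ R = A).filter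
            (fun R : Finset (Sym2 V) => e ∈ R), t ^ R.card)
        = t * ∑ R ∈ ((edgesIn G Λ).powerset.filter fun R : Finset (Sym2 V) =>
              oddVerts Λ R = A ∆ (Finset.univ.filter fun w : V => w ∈ e)).filter
            (fun R : Finset (Sym2 V) => e ∉ R), t ^ R.card := by
  intro V _ _ G _ Λ A t e he
  induction e using Sym2.ind with
  | _ x y =>
  have hΛ := (mem_edgesIn_iff.1 he).2
  have hx : x ∈ Λ := hΛ x (Sym2.mem_mk_left x y)
  have hy : y ∈ Λ := hΛ y (Sym2.mem_mk_right x y)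
  have hcancel : ∀ X : Finset V, (X ∆ {x, y}) ∆ {x, y} = X := fun X =>
    symmDiff_symmDiff_cancel_right _ X
  rw [filter_mem_sym2Mk_eq_pair, Finset.mul_sum]
  symm
  refine Finset.sum_nbij' (fun R' => insert s(x, y) R') (fun R => R.erase s(x, y)) ?_ ?_ ?_ ?_ ?_
  · -- `insert e` maps the second index set into the first
    intro R' hR'
    simp only [Finset.mem_filter, Finset.mem_powerset] at hR' ⊢
    obtain ⟨⟨hsub, hodd⟩, hnot⟩ := hR'
    refine ⟨⟨Finset.insert_subset he hsub, ?_⟩, Finset.mem_insert_self _ _⟩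
    rw [oddVerts_insert hx hy hnot, hodd, hcancel]
  · -- `erase e` maps the first index set into the second
    intro R hR
    simp only [Finset.mem_filter, Finset.mem_powerset] at hR ⊢
    obtain ⟨⟨hsub, hodd⟩, hmem⟩ := hR
    refine ⟨⟨(Finset.erase_subset _ _).trans hsub, ?_⟩, Finset.notMem_erase _ _⟩
    have h1 := oddVerts_insert (Λ := Λ) hx hy (Finset.notMem_erase (s(x, y)) R)
    rw [Finset.insert_erase hmem, hodd] at h1
    rw [h1, hcancel]
  · -- left inverse
    intro R' hR'
    simp only [Finset.mem_filter, Finset.mem_powerset] at hR'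
    exact Finset.erase_insert hR'.2
  · -- right inverse
    intro R hR
    simp only [Finset.mem_filter, Finset.mem_powerset] at hR
    exact Finset.insert_erase hR.2
  · -- weights: `t * t^|R'| = t^|insert e R'|`
    intro R' hR'
    simp only [Finset.mem_filter, Finset.mem_powerset] at hR'
    rw [Finset.card_insert_of_notMem hR'.2, pow_succ, mul_comm]

end Summit.CriticalPhenomena.Ising3DConformalLimit.Theorems.StrandShadowFootprint
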